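import Literature.InformationTheory.QuantumCodes.CorrectableRegions
import Mathlib.Combinatorics.SimpleGraph.Basic
import Mathlib.Analysis.SpecialFunctions.Pow.Real
import Mathlib.Algebra.Ring.GeomSum
import HarnessLib

/-!
# Connectivity constrains quantum codes: the separator bound on the dimension (Baspin–Krishna 2022) — PROVED

N. Baspin, A. Krishna, *Connectivity constrains quantum codes*, Quantum 6 (2022) 711 = arXiv:2106.00765
[BaspinKrishna2022] (held text `paper:arxiv-2106.00765`), §3.2 "Bound on the code dimension", read on the page:

> «Definition 10 (Connectivity graph). The connectivity graph of a code 𝒞 written G = G(𝒞) = (V, E) is defined so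
> that: V = [n], each vertex is associated with a qubit, and (u,v) ∈ E if and only if there exists a generator S ∈ 𝒮
> such that u, v ∈ supp(S).» (chunk p0008 L35–41)
> «Definition 11. Let G = (V,E) be a graph, α ∈ [1/2,1). Then the α-separator of G, written sep^α(G) is the smallest
> set S ⊂ V such that A, S, B are a disjoint partition, i.e. V = A ⊔ S ⊔ B; both of |A|, |B| ≤ α|V|; there are no
> edges between A and B.» «Definition 12. … G is (s, α)-separable … if ∀ r ∈ {1,…,n},
> max{sep^α(G') : G' ⊆ G, |G'| ≤ r} ≤ s(r).» «Remark: … any (s,α)-separable graph is (c_α·s, 1/2)-separable …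
> Henceforth, for brevity, we just say that a graph is s-separable» (chunk p0008 L94 – p0009 L12)
> «Definition 20. The function 𝒮_d is defined by the recurrence relation 𝒮_d(r) = c_α·s + 2𝒮_d(r/2), together with
> the condition that 𝒮_d(t) = 0 for all t < d» (chunk p0012 L51–55)
> «Lemma 21. Consider a graph G = (V,E) that is s-separable. For every d ≤ |G|, there exists a partition V = A ⊔ Ā,
> with A a union of decoupled subsets of size strictly less than d, and |Ā| = 𝒮_d(|V|).» (chunk p0012 L59–62)
> «Lemma 22. Let 𝒞 be a code on n qubits and G = G(𝒞) be the corresponding connectivity graph. If G is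
> s-separable, then we have the bound k ≤ 𝒮_d ∘ 𝒮_d(n).» (chunk p0012 L93–96; proof L97–105 and p0013 L1: recursive
> separation twice, the Union Lemma, and Lemma 19 = Bravyi–Poulin–Terhal's `k ≤ |C|`.)

What this file proves (KERNEL, no named fact), for stabilizer codes presented by a generator family
`g : G → 𝔽₂ⁿ × 𝔽₂ⁿ` (`S̄ = ⟨g⟩`), in the tree's vocabulary of `CorrectableRegions.lean`:
* `connGraph g` — Definition 10 as a `SimpleGraph (Fin n)`; `Decoupled g A B` (Definition 7: no generator meets both)
  and `decoupled_iff_forall_not_adj` (= «no edges between A and B» for disjoint sets);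
* `IsHalfSeparable g s` — Definitions 11/12 at `α = 1/2` for all induced subgraphs: every vertex set `W` splits as
  `W = A ⊔ (separator) ⊔ B` with `2|A|, 2|B| ≤ |W|`, no edge between `A` and `B`, and `|separator| ≤ s(|W|)`
  (the paper reduces general `α` to `1/2` by the quoted remark, so `c_α = 1` here — TODO(general form): `α ≠ 1/2`);
* `sepSum s d` — Definition 20 on `ℕ` (`r/2` the integer quotient): `𝒮_d(r) = 0` for `r < d`, else `s(r) + 2𝒮_d(⌊r/2⌋)`;
  `sepSum_mono`;
* `BaspinKrishna2022_lemma21` — Lemma 21 in labelled form: a labelling of a subset `A ⊆ W` by blocks of size `< d`,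
  pairwise decoupled (every generator meets at most one block — the hypothesis of the tree's Union Lemma
  `isCorrectableRegion_of_fibers`), with `|W ∖ A| ≤ 𝒮_d(|W|)` (the printed `=` is the extremal case; `≤` is what
  the proof gives and what Lemma 22 uses);
* **`BaspinKrishna2022_lemma22`** — Lemma 22: `k ≤ 𝒮_d(𝒮_d(n))` for every `[[n,k,d]]` stabilizer code (`d ≥ 1`) whose
  connectivity graph is `(s,1/2)`-separable with `s` monotone (monotonicity is implicit in print: Definition 12 makes
  `r ↦ max{…}` monotone).
* `sepSum_le_sum`, `sepSum_le_linear`, **`BaspinKrishna2022_corollary23`** — the unrolled recurrence, its closed form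
  for polynomial separators, and Corollary 23 with an explicit constant.

HONEST FRAMING (LADDER-QEC X1): a BARRIER theorem — poorly connected (sub-linearly separable) connectivity graphs force
few logical qubits at a given distance; for `s(r) = O(r^c)` the paper's Corollary 23 reads `k·d^{2(1−c)} = O(n)` and
«the only instances when we have constant rate and growing distance is when … s(r) = Θ(r)» (chunk p0013 L6–17).
Corollary 23 is typed in the explicit one-code form `BaspinKrishna2022_corollary23` (`s(r) ≤ C·r^c`, `0 ≤ c < 1` ⇒
`k·d^{2(1−c)} ≤ M²·n`, `M = C·2^{1−c}/(2^{1−c}−1)`, via the closed form `sepSum_le_linear : 𝒮_d(r) ≤ M·r·d^{c−1}` of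
the printed geometric-sum argument); the distance bound Theorem 17 / Theorem 1 (tree decompositions) and §3.3 are NOT
typed here. No novelty: a 2022 theorem, formalized; the tree's BPT10 (`BravyiPoulinTerhal2010_kd2_le_cn_holds`) is the 2D
Euclidean special case with the sharper exponent the separator method does not recover (chunk p0013 L19–27).

## References
* [BaspinKrishna2022] N. Baspin, A. Krishna, Quantum 6 (2022) 711 = arXiv:2106.00765, §2.1 Defs 4–7 (correctable /
  decoupled, chunk p0007 L49–90), Lemma 8 (Union Lemma, chunk p0008 L5–17), §2.1 Def 10, §2.2 Defs 11–12, §3.2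
  Lemma 19, Def 20, Lemmas 21–22, Cor 23 (chunks p0012–p0013).
* [BravyiPoulinTerhal2010] S. Bravyi, D. Poulin, B. Terhal, Phys. Rev. Lett. 104 (2010) 050503, Eqs. (5)–(8)
  (`k ≤ |C|`) and Lemma 2 (Union Lemma) — the tree's `le_card_compl_of_isCorrectable`, `isCorrectableRegion_of_fibers`.

## Mathlib / tree search
`rg -i 'baspin|separable|separator|treewidth' Literature/InformationTheory/QuantumCodes` (2026-08-27): nothing (the
`Literature/Combinatorics/SimpleGraph/` separator files concern Menger-type vertex cuts, another notion). Reused: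
`CorrectableRegions.lean` (`IsCorrectableRegion`, `.of_card_lt`, `fiber`, `isCorrectableRegion_of_fibers`,
`le_card_compl_of_isCorrectable`), `sympSupport` (`LocalityBounds.lean`), Mathlib `SimpleGraph`.
-/

namespace Literature.InformationTheory.QuantumCodes

open Finset

variable {n : ℕ} {G : Type*} (g : G → SympVec n)

/-! ### The connectivity graph and decoupled sets -/

/-- **The connectivity graph** of a generator family: qubits `u ≠ v` are adjacent iff some generator acts on both
(«(u,v) ∈ E if and only if there exists a generator S ∈ 𝒮 such that u, v ∈ supp(S)»). (definition)
[cite: BaspinKrishna2022, §2.1 Definition 10 (arXiv:2106.00765 chunk p0008 L35–41)] -/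
def connGraph : SimpleGraph (Fin n) where
  Adj u v := u ≠ v ∧ ∃ a, u ∈ sympSupport (g a) ∧ v ∈ sympSupport (g a)
  symm := ⟨fun _ _ ⟨h, a, hu, hv⟩ => ⟨h.symm, a, hv, hu⟩⟩
  loopless := ⟨fun _ h => h.1 rfl⟩

/-- Unfolding adjacency in the connectivity graph. [cite: BaspinKrishna2022, §2.1 Definition 10 (chunk p0008 L35–41)] -/
theorem connGraph_adj {u v : Fin n} :
    (connGraph g).Adj u v ↔ u ≠ v ∧ ∃ a, u ∈ sympSupport (g a) ∧ v ∈ sympSupport (g a) :=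
  Iff.rfl

/-- **Decoupled sets** («The subsets {Uᵢ} are said to be decoupled if no generators act on two Uᵢ at once»), for two
sets and a generator family: no generator meets both `A` and `B`. (definition)
[cite: BaspinKrishna2022, §2.1 Definition 7 (chunk p0007 L82–90)] -/
def Decoupled (A B : Finset (Fin n)) : Prop :=
  ∀ a, ∀ q ∈ sympSupport (g a), ∀ q' ∈ sympSupport (g a), q ∈ A → q' ∉ B

/-- Decoupling is symmetric. [cite: BaspinKrishna2022, §2.1 Definition 7 (chunk p0007 L82–90)] -/
theorem Decoupled.symm {A B : Finset (Fin n)} (h : Decoupled g A B) : Decoupled g B A :=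
  fun a q hq q' hq' hqB hq'A => h a q' hq' q hq hq'A hqB

/-- Decoupling passes to subsets. [cite: BaspinKrishna2022, §2.1 Definition 7 (chunk p0007 L82–90)] -/
theorem Decoupled.mono {A B A' B' : Finset (Fin n)} (h : Decoupled g A B) (hA : A' ⊆ A) (hB : B' ⊆ B) :
    Decoupled g A' B' :=
  fun a q hq q' hq' hqA hqB => h a q hq q' hq' (hA hqA) (hB hqB)

/-- «Consider two disjoint subsets U₁, U₂ ⊂ V. If there is no edge between U₁ and U₂ then they are decoupled»
— and conversely: for disjoint sets, decoupled iff no edge of the connectivity graph joins them.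
[cite: BaspinKrishna2022, §2.1 (remark after Definition 10, chunk p0008 L51–55)] -/
theorem decoupled_iff_forall_not_adj {A B : Finset (Fin n)} (hAB : Disjoint A B) :
    Decoupled g A B ↔ ∀ u ∈ A, ∀ v ∈ B, ¬ (connGraph g).Adj u v := by
  constructor
  · rintro h u hu v hv ⟨-, a, hua, hva⟩
    exact h a u hua v hva hu hv
  · intro h a q hq q' hq' hqA hq'B
    refine h q hqA q' hq'B ⟨?_, a, hq, hq'⟩
    rintro rfl
    exact disjoint_left.1 hAB hqA hq'B

/-! ### Separability (`α = 1/2`) -/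

/-- **A `1/2`-separation of the vertex set `W`** (Definition 11 at `α = 1/2`, for the subgraph induced on `W`):
`W = A ⊔ (W ∖ (A ∪ B)) ⊔ B` with `2|A| ≤ |W|`, `2|B| ≤ |W|` and no edge between `A` and `B` (the middle part is the
separator). (definition) [cite: BaspinKrishna2022, §2.2 Definition 11 (chunk p0008 L94–104)] -/
def IsHalfSeparation (W A B : Finset (Fin n)) : Prop :=
  A ⊆ W ∧ B ⊆ W ∧ Disjoint A B ∧ 2 * #A ≤ #W ∧ 2 * #B ≤ #W ∧ Decoupled g A B

/-- **`(s, 1/2)`-separability** of the connectivity graph (Definition 12 at `α = 1/2`): every induced subgraph, on any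
vertex set `W`, has a `1/2`-separation whose separator has at most `s(|W|)` vertices. The paper states Definition 12
for general `α ∈ [1/2,1)` and reduces to `α = 1/2` («any (s,α)-separable graph is (c_α·s, 1/2)-separable»); only
induced subgraphs need be tested (a subgraph with fewer edges is separated by the same sets). (definition)
-- TODO(general form): `α ≠ 1/2` with the constant `c_α`.
[cite: BaspinKrishna2022, §2.2 Definition 12 and the Remark after it (chunk p0008 L106 – p0009 L12)] -/
def IsHalfSeparable (s : ℕ → ℕ) : Prop :=
  ∀ W : Finset (Fin n), ∃ A B : Finset (Fin n), IsHalfSeparation g W A B ∧ #(W \ (A ∪ B)) ≤ s #W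

/-! ### The recursion `𝒮_d` (Definition 20) -/

/-- **The function `𝒮_d`** of Definition 20 on `ℕ` (with `c_α = 1`, the `α = 1/2` case, and `r/2` the integer
quotient): `𝒮_d(r) = 0` for `r < d` (and for `r = 0`), `𝒮_d(r) = s(r) + 2·𝒮_d(r/2)` otherwise. (definition)
[cite: BaspinKrishna2022, §3.2 Definition 20 (chunk p0012 L51–55)] -/
def sepSum (s : ℕ → ℕ) (d : ℕ) : ℕ → ℕ
  | r => if r < d ∨ r = 0 then 0 else s r + 2 * sepSum s d (r / 2)
  termination_by r => r
  decreasing_by omega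

/-- `𝒮_d(r) = 0` below `d`. [cite: BaspinKrishna2022, §3.2 Definition 20 (chunk p0012 L51–55)] -/
theorem sepSum_of_lt {s : ℕ → ℕ} {d r : ℕ} (h : r < d) : sepSum s d r = 0 := by
  rw [sepSum]; simp [h]

/-- The recurrence `𝒮_d(r) = s(r) + 2𝒮_d(⌊r/2⌋)` for `d ≤ r`, `r ≠ 0`. [cite: BaspinKrishna2022, §3.2 Definition 20 (chunk p0012 L51–55)] -/
theorem sepSum_of_le {s : ℕ → ℕ} {d r : ℕ} (h : d ≤ r) (hr : r ≠ 0) : sepSum s d r = s r + 2 * sepSum s d (r / 2) := by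
  rw [sepSum]; simp [Nat.not_lt.2 h, hr]

/-- `𝒮_d` is monotone when `s` is. [cite: BaspinKrishna2022, §3.2 Definition 20 with Lemma 21 (chunk p0012 L51–80)] -/
theorem sepSum_mono {s : ℕ → ℕ} (hs : Monotone s) (d : ℕ) : Monotone (sepSum s d) := by
  intro r r' hrr'
  induction r' using Nat.strong_induction_on generalizing r with
  | _ r' ih =>
    by_cases h : r < d ∨ r = 0
    · rw [sepSum]; simp [h]
    · push Not at h
      rw [sepSum_of_le h.1 h.2, sepSum_of_le (h.1.trans hrr') (by omega)]
      have := ih (r' / 2) (by omega) (r := r / 2) (Nat.div_le_div_right hrr')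
      have := hs hrr'
      omega

/-! ### Lemma 21: recursive separation -/

/-- A labelling of (part of) `W` by blocks: values `some ℓ` only on `W`, every block of size `< d`, and every
generator meets at most one block (the blocks are pairwise decoupled). [cite: BaspinKrishna2022, §3.2 Lemma 21 (chunk p0012 L59–62)] -/
def IsBlockLabelling (d : ℕ) (W : Finset (Fin n)) (β : Fin n → Option (List Bool)) : Prop :=
  (∀ q, (β q).isSome → q ∈ W) ∧ (∀ ℓ, #(fiber β (some ℓ)) < d) ∧
    ∀ a, ∀ q ∈ sympSupport (g a), ∀ q' ∈ sympSupport (g a), ∀ ℓ ℓ' : List Bool,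
      β q = some ℓ → β q' = some ℓ' → ℓ = ℓ'

/-- Base case: a set of fewer than `d` vertices is one block. [cite: BaspinKrishna2022, §3.2 Lemma 21, proof («this iterative process comes to a halt when |V_•| < d»; chunk p0012 L64–80)] -/
theorem isBlockLabelling_single {d : ℕ} {W : Finset (Fin n)} (hW : #W < d) :
    IsBlockLabelling g d W (fun q => if q ∈ W then some [] else none) ∧
      #(W.filter fun q => (if q ∈ W then some ([] : List Bool) else none) = none) = 0 := by
  refine ⟨⟨fun q hq => ?_, fun ℓ => ?_, fun a q _ q' _ ℓ ℓ' hq hq' => ?_⟩, ?_⟩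
  · by_contra h
    simp [h] at hq
  · refine lt_of_le_of_lt (card_le_card fun q hq => ?_) hW
    rw [mem_fiber] at hq
    by_contra h
    simp [h] at hq
  · have h1 : ℓ = [] := by
      by_cases h : q ∈ W
      · simpa [h] using hq.symm
      · simp [h] at hq
    have h2 : ℓ' = [] := by
      by_cases h : q' ∈ W
      · simpa [h] using hq'.symm
      · simp [h] at hq'
    rw [h1, h2]
  · rw [card_eq_zero, filter_eq_empty_iff]
    intro q hq
    simp [hq]

/-- Inductive step: glue block labellings of the two sides of a separation, prefixing the labels by the side.
[cite: BaspinKrishna2022, §3.2 Lemma 21, proof («they are separated further … A = V_{RR} ∪ V_{RL} ∪ V_{LR} ∪ V_{LL}»; chunk p0012 L64–80)] -/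
def glue (A B : Finset (Fin n)) (βA βB : Fin n → Option (List Bool)) : Fin n → Option (List Bool) := fun q =>
  if q ∈ A then (βA q).map (List.cons false) else if q ∈ B then (βB q).map (List.cons true) else none

/-- The glued labelling is a block labelling of `W`, and its unlabelled part of `W` lies in the separator together
with the unlabelled parts of the two sides. [cite: BaspinKrishna2022, §3.2 Lemma 21, proof (chunk p0012 L64–80)] -/
theorem isBlockLabelling_glue {d : ℕ} {W A B : Finset (Fin n)} (hsepn : IsHalfSeparation g W A B)
    {βA βB : Fin n → Option (List Bool)} (hA : IsBlockLabelling g d A βA) (hB : IsBlockLabelling g d B βB)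
    (hd : 1 ≤ d) :
    IsBlockLabelling g d W (glue A B βA βB) ∧
      #(W.filter fun q => glue A B βA βB q = none) ≤
        #(W \ (A ∪ B)) + #(A.filter fun q => βA q = none) + #(B.filter fun q => βB q = none) := by
  obtain ⟨hAW, hBW, hdisj, -, -, hdec⟩ := hsepn
  obtain ⟨hA1, hA2, hA3⟩ := hA
  obtain ⟨hB1, hB2, hB3⟩ := hB
  have hnotA : ∀ q ∈ B, q ∉ A := fun q hq hqA => disjoint_left.1 hdisj hqA hq
  refine ⟨⟨fun q hq => ?_, fun ℓ => ?_, fun a q hq q' hq' ℓ ℓ' hβq hβq' => ?_⟩, ?_⟩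
  · -- labelled vertices lie in A ∪ B ⊆ W
    unfold glue at hq
    by_cases hqA : q ∈ A
    · exact hAW hqA
    · by_cases hqB : q ∈ B
      · exact hBW hqB
      · simp [hqA, hqB] at hq
  · -- blocks are blocks of one side
    rcases ℓ with _ | ⟨b, ℓ₀⟩
    · have h0 : fiber (glue A B βA βB) (some []) = ∅ := by
        refine filter_eq_empty_iff.2 fun q _ => ?_
        unfold glue
        by_cases hqA : q ∈ A
        · cases βA q <;> simp [hqA]
        · by_cases hqB : q ∈ B
          · cases βB q <;> simp [hqA, hqB]
          · simp [hqA, hqB]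
      rw [h0, card_empty]
      exact hd
    · cases b
      · refine lt_of_le_of_lt (card_le_card fun q hq => ?_) (hA2 ℓ₀)
        rw [mem_fiber] at hq ⊢
        unfold glue at hq
        by_cases hqA : q ∈ A
        · cases h : βA q <;> simp_all
        · by_cases hqB : q ∈ B
          · cases h : βB q <;> simp_all
          · simp_all
      · refine lt_of_le_of_lt (card_le_card fun q hq => ?_) (hB2 ℓ₀)
        rw [mem_fiber] at hq ⊢
        unfold glue at hq
        by_cases hqA : q ∈ A
        · cases h : βA q <;> simp_all
        · by_cases hqB : q ∈ B
          · cases h : βB q <;> simp_all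
          · simp_all
  · -- every generator meets at most one block
    unfold glue at hβq hβq'
    by_cases hqA : q ∈ A
    · by_cases hq'A : q' ∈ A
      · cases hq0 : βA q with
        | none => simp [hqA, hq0] at hβq
        | some ℓ₀ =>
          cases hq0' : βA q' with
          | none => simp [hq'A, hq0'] at hβq'
          | some ℓ₀' =>
            simp only [hqA, hq0, hq'A, hq0', if_true, Option.map_some, Option.some.injEq] at hβq hβq'
            rw [← hβq, ← hβq', hA3 a q hq q' hq' ℓ₀ ℓ₀' hq0 hq0']
      · by_cases hq'B : q' ∈ B
        · exact absurd hq'B (hdec a q hq q' hq' hqA)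
        · simp [hq'A, hq'B] at hβq'
    · by_cases hqB : q ∈ B
      · by_cases hq'A : q' ∈ A
        · exact absurd hqB (hdec a q' hq' q hq hq'A)
        · by_cases hq'B : q' ∈ B
          · cases hq0 : βB q with
            | none => simp [hqA, hqB, hq0] at hβq
            | some ℓ₀ =>
              cases hq0' : βB q' with
              | none => simp [hq'A, hq'B, hq0'] at hβq'
              | some ℓ₀' =>
                simp only [hqA, hqB, hq0, hq'A, hq'B, hq0', if_true, if_false, Option.map_some, Option.some.injEq] at hβq hβq'
                rw [← hβq, ← hβq', hB3 a q hq q' hq' ℓ₀ ℓ₀' hq0 hq0']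
          · simp [hq'A, hq'B] at hβq'
      · simp [hqA, hqB] at hβq
  · -- the unlabelled part of W
    calc #(W.filter fun q => glue A B βA βB q = none)
        ≤ #((W \ (A ∪ B)) ∪ ((A.filter fun q => βA q = none) ∪ (B.filter fun q => βB q = none))) := by
          refine card_le_card fun q hq => ?_
          rw [mem_filter] at hq
          obtain ⟨hqW, hq⟩ := hq
          unfold glue at hq
          rw [mem_union, mem_union, mem_sdiff, mem_union, mem_filter, mem_filter]
          by_cases hqA : q ∈ A
          · cases h : βA q with
            | none => exact Or.inr (Or.inl ⟨hqA, rfl⟩)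
            | some ℓ₀ => simp [hqA, h] at hq
          · by_cases hqB : q ∈ B
            · cases h : βB q with
              | none => exact Or.inr (Or.inr ⟨hqB, rfl⟩)
              | some ℓ₀ => simp [hqA, hqB, h] at hq
            · exact Or.inl ⟨hqW, fun h => h.elim hqA hqB⟩
      _ ≤ #(W \ (A ∪ B)) + #((A.filter fun q => βA q = none) ∪ (B.filter fun q => βB q = none)) := card_union_le _ _
      _ ≤ #(W \ (A ∪ B)) + (#(A.filter fun q => βA q = none) + #(B.filter fun q => βB q = none)) :=
          Nat.add_le_add_left (card_union_le _ _) _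
      _ = _ := (Nat.add_assoc _ _ _).symm

/-- **Lemma 21 (recursive separation), labelled form.** If the connectivity graph is `(s,1/2)`-separable with `s`
monotone and `d ≥ 1`, then every vertex set `W` carries a block labelling — blocks of size `< d`, pairwise decoupled —
whose unlabelled part `Ā = W ∖ A` has `|Ā| ≤ 𝒮_d(|W|)` («there exists a partition V = A ⊔ Ā, with A a union of
decoupled subsets of size strictly less than d, and |Ā| = 𝒮_d(|V|)»; the recursion gives `≤`).
[cite: BaspinKrishna2022, §3.2 Lemma 21 (statement chunk p0012 L59–62; proof L63–80)] -/
theorem BaspinKrishna2022_lemma21 {s : ℕ → ℕ} (hsep : IsHalfSeparable g s) (hs : Monotone s) {d : ℕ} (hd : 1 ≤ d)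
    (W : Finset (Fin n)) :
    ∃ β : Fin n → Option (List Bool), IsBlockLabelling g d W β ∧ #(W.filter fun q => β q = none) ≤ sepSum s d #W := by
  induction hW : #W using Nat.strong_induction_on generalizing W with
  | _ m ih =>
    by_cases hlt : #W < d
    · refine ⟨_, (isBlockLabelling_single g hlt).1, ?_⟩
      rw [(isBlockLabelling_single g hlt).2]
      exact Nat.zero_le _
    · obtain ⟨A, B, hsepn, hcard⟩ := hsep W
      have hA : #A < #W := by have := hsepn.2.2.2.1; omega
      have hB : #B < #W := by have := hsepn.2.2.2.2.1; omega
      obtain ⟨βA, hβA, hcA⟩ := ih #A (by omega) A rfl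
      obtain ⟨βB, hβB, hcB⟩ := ih #B (by omega) B rfl
      obtain ⟨hglue, hcount⟩ := isBlockLabelling_glue g hsepn hβA hβB hd
      refine ⟨_, hglue, hcount.trans ?_⟩
      subst hW
      rw [sepSum_of_le (Nat.not_lt.1 hlt) (by omega)]
      have h2A : sepSum s d #A ≤ sepSum s d (#W / 2) := sepSum_mono hs d (by have := hsepn.2.2.2.1; omega)
      have h2B : sepSum s d #B ≤ sepSum s d (#W / 2) := sepSum_mono hs d (by have := hsepn.2.2.2.2.1; omega)
      omega

/-! ### Lemma 22: the dimension bound -/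

/-- The labelled part of a block labelling is correctable (Union Lemma over blocks of size `< d`).
[cite: BaspinKrishna2022, §3.2 Lemma 22, proof («Since every subset V_• has size less than d, we can use the Union Lemma to show that A is correctable»; chunk p0012 L103–105)] -/
theorem IsBlockLabelling.isCorrectableRegion {S : Submodule (ZMod 2) (SympVec n)} {k d : ℕ} (hcode : IsAdditiveCode S k d)
    (hS : S = Submodule.span (ZMod 2) (Set.range g)) {W : Finset (Fin n)} {β : Fin n → Option (List Bool)}
    (hβ : IsBlockLabelling g d W β) : IsCorrectableRegion S (univ.filter fun q => (β q).isSome) :=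
  isCorrectableRegion_of_fibers β g hS hβ.2.2 fun ℓ => IsCorrectableRegion.of_card_lt hcode.2.2.1 (hβ.2.1 ℓ)

/-- **Baspin–Krishna 2022, Lemma 22 (= Theorem 2 before asymptotics): `k ≤ 𝒮_d(𝒮_d(n))`.** For an `[[n,k,d]]`
stabilizer code (`d ≥ 1`) presented by generators `g` whose connectivity graph is `(s,1/2)`-separable, `s` monotone:
`k ≤ 𝒮_d(𝒮_d(n))`. Proof as printed: separate recursively to get `A` (blocks of size `< d`, decoupled, hence
correctable by the Union Lemma) with `|Ā| ≤ 𝒮_d(n)`; separate `Ā` again to get `B` correctable with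
`|Ā ∖ B| ≤ 𝒮_d(|Ā|) ≤ 𝒮_d(𝒮_d(n))`; then `k ≤ |C|` for `C = (A ∪ B)ᶜ` (Lemma 19 = Bravyi–Poulin–Terhal, the tree's
`le_card_compl_of_isCorrectable`). [cite: BaspinKrishna2022, §3.2 Lemma 22 (chunk p0012 L93–105, p0013 L1)] -/
theorem BaspinKrishna2022_lemma22 {S : Submodule (ZMod 2) (SympVec n)} {k d : ℕ} (hcode : IsAdditiveCode S k d)
    (hS : S = Submodule.span (ZMod 2) (Set.range g)) (hd : 1 ≤ d) {s : ℕ → ℕ} (hsep : IsHalfSeparable g s)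
    (hs : Monotone s) : k ≤ sepSum s d (sepSum s d n) := by
  -- first separation: A₁ labelled, R₁ unlabelled
  obtain ⟨β₁, hβ₁, hc₁⟩ := BaspinKrishna2022_lemma21 g hsep hs hd univ
  rw [card_univ, Fintype.card_fin] at hc₁
  set R₁ : Finset (Fin n) := univ.filter fun q => β₁ q = none with hR₁
  -- second separation inside R₁
  obtain ⟨β₂, hβ₂, hc₂⟩ := BaspinKrishna2022_lemma21 g hsep hs hd R₁
  have hA₁ := hβ₁.isCorrectableRegion g hcode hS
  have hA₂ := hβ₂.isCorrectableRegion g hcode hS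
  refine (le_card_compl_of_isCorrectable hcode hA₁ hA₂).trans ?_
  refine (card_le_card fun q hq => ?_).trans (hc₂.trans (sepSum_mono hs d hc₁))
  rw [mem_compl, mem_union, not_or, mem_filter, mem_filter] at hq
  obtain ⟨h1, h2⟩ := hq
  simp only [mem_univ, true_and, Bool.not_eq_true, Option.isSome_eq_false_iff, Option.isNone_iff_eq_none] at h1 h2
  exact mem_filter.2 ⟨mem_filter.2 ⟨mem_univ _, h1⟩, h2⟩

/-! ### Corollary 23: polynomial separators, `k · d^{2(1−c)} = O(n)` with an explicit constant -/

/-- **Unrolling the recurrence**: if `⌊r/2^I⌋ < d` then `𝒮_d(r) ≤ Σ_{i<I} 2^i · s(⌊r/2^i⌋)` (equality when `I` is the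
least such index; the proof of Lemma 21 accumulates exactly these separator costs).
[cite: BaspinKrishna2022, §3.2 Lemma 21, proof («The size of Ā is therefore bounded by the recursive function …»; chunk p0012 L74–80) and App. (closed form of the recurrence, cited p0012 L82–83)] -/
theorem sepSum_le_sum (s : ℕ → ℕ) (d : ℕ) : ∀ (I r : ℕ), r / 2 ^ I < d →
    sepSum s d r ≤ ∑ i ∈ range I, 2 ^ i * s (r / 2 ^ i)
  | 0, r, h => by
    rw [pow_zero, Nat.div_one] at h
    rw [sepSum_of_lt h, sum_range_zero]
  | I + 1, r, h => by
    by_cases hr : r < d ∨ r = 0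
    · rw [sepSum]; simp [hr]
    · push Not at hr
      rw [sepSum_of_le hr.1 hr.2, sum_range_succ', pow_zero, Nat.div_one, one_mul, add_comm]
      have h' : r / 2 / 2 ^ I < d := by rwa [Nat.div_div_eq_div_mul, mul_comm, ← pow_succ]
      have ih := sepSum_le_sum s d I (r / 2) h'
      have hre : ∀ i ∈ range I, 2 ^ (i + 1) * s (r / 2 ^ (i + 1)) = 2 * (2 ^ i * s (r / 2 / 2 ^ i)) := fun i _ => by
        rw [Nat.div_div_eq_div_mul, mul_comm 2 (2 ^ i), ← pow_succ, pow_succ]; ring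
      rw [sum_congr rfl hre, ← mul_sum]
      omega

/-- The least number of halvings that brings `r` below `d` (for `d ≥ 1`): `⌊r/2^I⌋ < d` and, if `I ≥ 1`,
`d · 2^{I-1} ≤ r`. [cite: BaspinKrishna2022, §3.2 Lemma 21, proof («this iterative process comes to a halt when |V_•| < d»; chunk p0012 L74–78)] -/
theorem exists_halvings {d : ℕ} (hd : 1 ≤ d) (r : ℕ) :
    ∃ I : ℕ, r / 2 ^ I < d ∧ (1 ≤ I → d * 2 ^ (I - 1) ≤ r) := by
  classical
  have hex : ∃ I : ℕ, r / 2 ^ I < d := ⟨r, by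
    rw [Nat.div_eq_of_lt (Nat.lt_two_pow_self)]; exact hd⟩
  refine ⟨Nat.find hex, Nat.find_spec hex, fun hI => ?_⟩
  have hmin := Nat.find_min hex (m := Nat.find hex - 1) (by omega)
  rw [not_lt] at hmin
  exact (Nat.le_div_iff_mul_le (by positivity)).1 hmin

section Real

open Real

/-- `(2^i)^{1-c} = (2^{1-c})^i` in `ℝ`. [folklore] -/
private theorem two_pow_rpow (i : ℕ) (e : ℝ) : ((2 : ℝ) ^ i) ^ e = ((2 : ℝ) ^ e) ^ i := by
  rw [← rpow_natCast (2 : ℝ) i, ← rpow_mul (by norm_num), mul_comm, rpow_mul (by norm_num), rpow_natCast]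

/-- One term of the unrolled sum under a polynomial separator: `2^i · s(⌊r/2^i⌋) ≤ C · r^c · (2^{1−c})^i`.
[cite: BaspinKrishna2022, §3.2 (after Lemma 21: «when s(r) = O(r^c), 𝒮_d(r) = O(d^{c−1} r)»; chunk p0012 L82–83)] -/
private theorem term_le {s : ℕ → ℕ} {C c : ℝ} (hC : 0 ≤ C) (hc : 0 ≤ c) (hsC : ∀ m : ℕ, (s m : ℝ) ≤ C * (m : ℝ) ^ c)
    (r i : ℕ) : (2 : ℝ) ^ i * (s (r / 2 ^ i) : ℝ) ≤ C * (r : ℝ) ^ c * ((2 : ℝ) ^ (1 - c)) ^ i := by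
  have h2 : (0 : ℝ) < (2 : ℝ) ^ i := by positivity
  have hq : ((r / 2 ^ i : ℕ) : ℝ) ≤ (r : ℝ) / (2 : ℝ) ^ i := by
    have := Nat.cast_div_le (m := r) (n := 2 ^ i) (α := ℝ)
    simpa using this
  calc (2 : ℝ) ^ i * (s (r / 2 ^ i) : ℝ) ≤ (2 : ℝ) ^ i * (C * (((r / 2 ^ i : ℕ) : ℝ)) ^ c) :=
        mul_le_mul_of_nonneg_left (hsC _) h2.le
    _ ≤ (2 : ℝ) ^ i * (C * ((r : ℝ) / (2 : ℝ) ^ i) ^ c) :=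
        mul_le_mul_of_nonneg_left (mul_le_mul_of_nonneg_left (rpow_le_rpow (Nat.cast_nonneg _) hq hc) hC) h2.le
    _ = C * (r : ℝ) ^ c * ((2 : ℝ) ^ i / ((2 : ℝ) ^ i) ^ c) := by
        rw [div_rpow (Nat.cast_nonneg _) h2.le]; ring
    _ = C * (r : ℝ) ^ c * ((2 : ℝ) ^ (1 - c)) ^ i := by
        rw [← two_pow_rpow, rpow_sub h2, rpow_one]

/-- Geometric sum with ratio `q > 1`: `Σ_{i<I} q^i ≤ q^I / (q - 1)`. [folklore] -/
private theorem geom_sum_le_div {q : ℝ} (hq : 1 < q) (I : ℕ) : ∑ i ∈ range I, q ^ i ≤ q ^ I / (q - 1) := by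
  have hq1 : 0 < q - 1 := by linarith
  rw [le_div_iff₀ hq1, geom_sum_mul]
  linarith

/-- **Closed form of the recurrence (App. of the paper): for `s(r) ≤ C·r^c` with `0 ≤ c < 1` and `d ≥ 1`,
`𝒮_d(r) ≤ M · r · d^{c−1}` with `M = C · 2^{1−c} / (2^{1−c} − 1)`** («In appendix … we show that when
`s(r) = O(r^c)`, `𝒮_d(r) = O(d^{c−1} r)`»; the explicit constant is ours, read off the geometric sum).
[cite: BaspinKrishna2022, §3.2 (remark after Lemma 21, chunk p0012 L82–83) and Corollary 23 (chunk p0013 L6–12)] -/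
theorem sepSum_le_linear {s : ℕ → ℕ} {C c : ℝ} (hC : 0 ≤ C) (hc0 : 0 ≤ c) (hc1 : c < 1)
    (hsC : ∀ m : ℕ, (s m : ℝ) ≤ C * (m : ℝ) ^ c) {d : ℕ} (hd : 1 ≤ d) (r : ℕ) :
    (sepSum s d r : ℝ) ≤ C * (2 : ℝ) ^ (1 - c) / ((2 : ℝ) ^ (1 - c) - 1) * (r : ℝ) * (d : ℝ) ^ (c - 1) := by
  set q : ℝ := (2 : ℝ) ^ (1 - c) with hq_def
  have hq1 : 1 < q := by
    rw [hq_def]; exact one_lt_rpow (by norm_num) (by linarith)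
  have hq0 : 0 < q := by linarith
  have hdpos : (0 : ℝ) < d := by exact_mod_cast hd
  have hM : 0 ≤ C * q / (q - 1) := div_nonneg (mul_nonneg hC hq0.le) (by linarith)
  obtain ⟨I, hI, hImin⟩ := exists_halvings hd r
  rcases Nat.eq_zero_or_pos I with hI0 | hIpos
  · -- r < d: 𝒮_d(r) = 0
    subst hI0
    rw [pow_zero, Nat.div_one] at hI
    rw [sepSum_of_lt hI, Nat.cast_zero]
    exact mul_nonneg (mul_nonneg hM (Nat.cast_nonneg _)) (rpow_nonneg hdpos.le _)
  · have hrd : d * 2 ^ (I - 1) ≤ r := hImin hIpos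
    have hrpos : (0 : ℝ) < r := by
      have : 1 ≤ r := le_trans (Nat.one_le_iff_ne_zero.2 (by positivity)) hrd
      exact_mod_cast this
    -- 2^I ≤ 2r/d
    have h2I : (2 : ℝ) ^ I ≤ 2 * (r : ℝ) / d := by
      rw [le_div_iff₀ hdpos]
      have h1 : (2 : ℝ) ^ I = 2 * (2 : ℝ) ^ (I - 1) := by
        rw [← pow_succ']; congr 1; omega
      have h2 : ((d * 2 ^ (I - 1) : ℕ) : ℝ) ≤ (r : ℝ) := by exact_mod_cast hrd
      push_cast at h2
      rw [h1]
      nlinarith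
    -- unroll and bound term by term
    have hsum := sepSum_le_sum s d I r hI
    have hsumR : (sepSum s d r : ℝ) ≤ ∑ i ∈ range I, (2 : ℝ) ^ i * (s (r / 2 ^ i) : ℝ) := by
      have : ((sepSum s d r : ℕ) : ℝ) ≤ ((∑ i ∈ range I, 2 ^ i * s (r / 2 ^ i) : ℕ) : ℝ) := by exact_mod_cast hsum
      simpa [Nat.cast_sum, Nat.cast_mul, Nat.cast_pow] using this
    have hterms : ∑ i ∈ range I, (2 : ℝ) ^ i * (s (r / 2 ^ i) : ℝ) ≤ ∑ i ∈ range I, C * (r : ℝ) ^ c * q ^ i :=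
      sum_le_sum fun i _ => term_le hC hc0 hsC r i
    rw [← mul_sum] at hterms
    have hgeom : ∑ i ∈ range I, q ^ i ≤ q ^ I / (q - 1) := geom_sum_le_div hq1 I
    -- q^I = (2^I)^{1-c} ≤ (2r/d)^{1-c}
    have hqI : q ^ I ≤ (2 * (r : ℝ) / d) ^ (1 - c) := by
      rw [hq_def, ← two_pow_rpow]
      exact rpow_le_rpow (by positivity) h2I (by linarith)
    have hCr : 0 ≤ C * (r : ℝ) ^ c := mul_nonneg hC (rpow_nonneg hrpos.le _)
    calc (sepSum s d r : ℝ) ≤ C * (r : ℝ) ^ c * ∑ i ∈ range I, q ^ i := hsumR.trans hterms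
      _ ≤ C * (r : ℝ) ^ c * ((2 * (r : ℝ) / d) ^ (1 - c) / (q - 1)) :=
          mul_le_mul_of_nonneg_left (hgeom.trans (div_le_div_of_nonneg_right hqI (by linarith))) hCr
      _ = C * q / (q - 1) * (r : ℝ) * (d : ℝ) ^ (c - 1) := by
          rw [div_rpow (by positivity) hdpos.le, mul_rpow (by norm_num) hrpos.le, ← hq_def,
            show (c - 1 : ℝ) = -(1 - c) by ring, rpow_neg hdpos.le]
          have hr1 : (r : ℝ) ^ c * (r : ℝ) ^ (1 - c) = r := by
            rw [← rpow_add hrpos, show c + (1 - c) = (1 : ℝ) by ring, rpow_one]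
          conv_rhs => rw [← hr1]
          ring

/-- **Baspin–Krishna 2022, Corollary 23 (explicit form): polynomial separators force `k · d^{2(1−c)} = O(n)`.**
«Let 𝒞 = {𝒞ₙ} be a family of ⟦n,k,d⟧ quantum LDPC codes with a s-separable family of connectivity graphs … If
exists a constant c ≤ 1 such that the separator has the form s(r) = O(r^c), then k·d^{2(1−c)} = O(n).» Here, for ONE
code: if the connectivity graph is `(s,1/2)`-separable with `s` monotone and `s(r) ≤ C·r^c` (`0 ≤ c < 1`), then
`k · d^{2(1−c)} ≤ M² · n` with `M = C·2^{1−c}/(2^{1−c} − 1)` (Lemma 22 and the closed form `𝒮_d(r) ≤ M r d^{c−1}`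
twice). [cite: BaspinKrishna2022, §3.2 Corollary 23 (chunk p0013 L6–12), via Lemma 22 (chunk p0012 L93–96)] -/
theorem BaspinKrishna2022_corollary23 {S : Submodule (ZMod 2) (SympVec n)} {k d : ℕ} (hcode : IsAdditiveCode S k d)
    (hS : S = Submodule.span (ZMod 2) (Set.range g)) (hd : 1 ≤ d) {s : ℕ → ℕ} (hsep : IsHalfSeparable g s)
    (hs : Monotone s) {C c : ℝ} (hC : 0 ≤ C) (hc0 : 0 ≤ c) (hc1 : c < 1) (hsC : ∀ m : ℕ, (s m : ℝ) ≤ C * (m : ℝ) ^ c) :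
    (k : ℝ) * (d : ℝ) ^ (2 * (1 - c)) ≤ (C * (2 : ℝ) ^ (1 - c) / ((2 : ℝ) ^ (1 - c) - 1)) ^ 2 * n := by
  set M : ℝ := C * (2 : ℝ) ^ (1 - c) / ((2 : ℝ) ^ (1 - c) - 1) with hM_def
  have hq1 : 1 < (2 : ℝ) ^ (1 - c) := one_lt_rpow (by norm_num) (by linarith)
  have hM : 0 ≤ M := div_nonneg (mul_nonneg hC (by positivity)) (by linarith)
  have hdpos : (0 : ℝ) < d := by exact_mod_cast hd
  have hdc : 0 < (d : ℝ) ^ (c - 1) := rpow_pos_of_pos hdpos _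
  -- k ≤ 𝒮(𝒮(n)) ≤ M · 𝒮(n) · d^{c-1} ≤ M · (M n d^{c-1}) · d^{c-1}
  have h1 : (k : ℝ) ≤ (sepSum s d (sepSum s d n) : ℝ) := by exact_mod_cast BaspinKrishna2022_lemma22 g hcode hS hd hsep hs
  have h2 := sepSum_le_linear hC hc0 hc1 hsC hd (sepSum s d n)
  have h3 := sepSum_le_linear hC hc0 hc1 hsC hd n
  rw [← hM_def] at h2 h3
  have h4 : (k : ℝ) ≤ M * (M * n * (d : ℝ) ^ (c - 1)) * (d : ℝ) ^ (c - 1) :=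
    h1.trans (h2.trans (mul_le_mul_of_nonneg_right (mul_le_mul_of_nonneg_left h3 hM) hdc.le))
  have hdd : (d : ℝ) ^ (c - 1) * (d : ℝ) ^ (c - 1) * (d : ℝ) ^ (2 * (1 - c)) = 1 := by
    rw [← rpow_add hdpos, ← rpow_add hdpos, show c - 1 + (c - 1) + 2 * (1 - c) = (0 : ℝ) by ring, rpow_zero]
  calc (k : ℝ) * (d : ℝ) ^ (2 * (1 - c)) ≤ M * (M * n * (d : ℝ) ^ (c - 1)) * (d : ℝ) ^ (c - 1) * (d : ℝ) ^ (2 * (1 - c)) :=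
        mul_le_mul_of_nonneg_right h4 (rpow_nonneg hdpos.le _)
    _ = M ^ 2 * n * ((d : ℝ) ^ (c - 1) * (d : ℝ) ^ (c - 1) * (d : ℝ) ^ (2 * (1 - c))) := by ring
    _ = M ^ 2 * n := by rw [hdd, mul_one]

end Real

end Literature.InformationTheory.QuantumCodes
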